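import Summits.ResolutionOfSingularities.ResolutionOfSingularities.Theorems.FrobeniusClosingPatchingRelPerfectCoreRungTowerEuclid
import HarnessLib

/-!
# Crux `PatchingRelPerfect` (stmt-ResolutionOfSingularities-16161), chain w52 — rung tool
# TANGENT EUCLID, part 1: chart images and re-lettering for `K = (η t + cᵏ) + (t^β)` (any ring)

[OURS · L1 W5.2 · rung tool, kernel (iii) support] Stub-1's Euclidean tower
`CoreRungTower.euclid_exponents` (`…CoreRungTowerEuclid.lean`) principalises `(w)ᵅ + (t^β)` for a
quasi-regular family `(t, w)` with regular quotient, i.e. when the hypersurfaces `V(w_l)` are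
TRANSVERSAL to `E = V(t)`.  The FINISHING step of the simplest non-graded member of the core's
`𝔪`-primary hunt family (`I = (x₃² + x₀³) + 𝔪⁴`, CHAIN v1.5 §4 kernel (iii) at `ℓ = 2`; hand route
in this seat's note `NONGRADED-CUSP-MEMBER.md`, evidence #52 on the crux item) produces instead,
after the first order drop, an order-one residual `K = (h) + (t^β)` whose maximal-contact
hypersurface `H = V(h)`, `h = η t + cᵏ` (`η` a unit, `k ≥ 2`), is regular but TANGENT to
`E = V(t)` of order `k` along the regular locus `V(t, c)` (already on the `x₀`-chart of `Bl_𝔪`: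
`I·B = u² · (u + c², u²)`).  This file proves that ONE blowing up of the REDUCED tangency locus
`V(t, c)` re-letters the problem into stub-1's Euclid: on the `c`-chart `t = cτ`,
`h = c · h′` with `h′ = ητ + cᵏ⁻¹`, `(c, h′) = (c, τ)` is TRANSVERSAL (weakly regular with regular
quotient — the chart family of `…CoreRungTowerCharts.lean`), and
`K · B_c = c · ((h′) + (c^{kβ-1}))` since `η τ ≡ -cᵏ⁻¹ (mod h′)`; on the `t`-chart everything is
the Cartier divisor `(t^N)` by coprimality (the unit `η` is nilpotent in the relevant
quotients).  The Euclid factors `(h′)ⁱ + (cʲ)` upstairs are the images of the base avatars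
`(h)ⁱ + (cⁱ⁺ʲ)` (twisted by `cⁱ`).  PROVED, every regular ring `R`, no dimension /
characteristic / residue-field hypothesis:

* (part 2, `…TangentEuclid.lean`) `CoreRungTower.tangent_euclid_exponents` — for all `k ≥ 2`,
  `β ≥ 1` there is a list `L` of exponent pairs such that for every regular ring `R`, every unit
  `η`, every quasi-regular pair `(t, c)` with `R/(t, c)` regular, every blowing up of `Spec R`
  along `((η t + cᵏ) + (t^β)) · ∏_{(i,j) ∈ L} ((η t + cᵏ)ⁱ + (cⁱ⁺ʲ)) · (t, c)` is regular;
* (this file) the ideal algebra behind the two charts, over an arbitrary commutative ring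
  (`tangentK_cChart`, `tangentFactor_cChart`, `tangentK_tChart`, `tangentFactor_tChart`), their
  chart forms (`map_chartBase_one_tangent`, `map_chartBase_one_tangentFactor`,
  `map_chartBase_zero_tangent`, `map_chartBase_zero_tangentFactor`), the re-lettering
  (`isWeaklyRegular_exc_strict`, `isRegularRing_quot_exc_strict`) and elementary lemmas
  (`sup_span_singleton_eq_of_sub_mem`, `eq_top_of_isUnit_eq_sub`, `isWeaklyRegular_pair_congr`).

FORMAT evidence / a tool for kernel-(iii) certificates (CHAIN §1 (A)); nothing here is a statement of
the manuscript under review.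

## References

* Q. Liu, *Algebraic Geometry and Arithmetic Curves*, OUP 2002, Thm. 8.1.19 (a). [Liu2002]
* The Stacks Project, Tags 080A, 080B, 0804, 0BIQ. [StacksProject]
* O. Zariski, P. Samuel, *Commutative Algebra II*, Appendix 5. [ZariskiSamuel1960]
-/

-- `Summit.<Summit>.<Sub>.Theorems` with `Sub = Summit` (single-conjunct summit, D-0017)
set_option linter.dupNamespace false

noncomputable section

open CategoryTheory CategoryTheory.Limits AlgebraicGeometry Literature.AlgebraicGeometry.Resolution

namespace Summit.ResolutionOfSingularities.ResolutionOfSingularities.Theorems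

universe u

namespace CoreRungTower

/-! ## Elementary lemmas -/

/-- `(p) + (a) = (p) + (b)` if `a ≡ b (mod p)`. [folklore] -/
theorem sup_span_singleton_eq_of_sub_mem {R : Type*} [CommRing R] {p a b : R}
    (h : a - b ∈ Ideal.span {p}) :
    Ideal.span {p} ⊔ Ideal.span {a} = Ideal.span {p} ⊔ Ideal.span {b} := by
  apply le_antisymm
  · refine sup_le le_sup_left ?_
    rw [Ideal.span_singleton_le_iff_mem]
    have : a = (a - b) + b := by ring
    rw [this]
    exact Ideal.add_mem _ (Ideal.mem_sup_left h) (Ideal.mem_sup_right (Ideal.mem_span_singleton_self b))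
  · refine sup_le le_sup_left ?_
    rw [Ideal.span_singleton_le_iff_mem]
    have : b = a - (a - b) := by ring
    rw [this]
    exact Ideal.sub_mem _ (Ideal.mem_sup_right (Ideal.mem_span_singleton_self a)) (Ideal.mem_sup_left h)

/-- **Coprimality by a unit that becomes nilpotent**: if the unit `u` equals `h - n` and an ideal
`P` contains a power of `h` and a power of `n`, then `P = R` (in `R/P` the unit `u` is nilpotent).
[folklore] -/
theorem eq_top_of_isUnit_eq_sub {R : Type*} [CommRing R] {u h n : R} (hu : IsUnit u)
    (he : u = h - n) (P : Ideal R) (i N : ℕ) (hh : h ^ i ∈ P) (hn : n ^ N ∈ P) : P = ⊤ := by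
  rw [← Ideal.Quotient.zero_eq_one_iff, ← isUnit_zero_iff]
  have hhn : IsNilpotent (Ideal.Quotient.mk P h) :=
    ⟨i, by rw [← map_pow, Ideal.Quotient.eq_zero_iff_mem]; exact hh⟩
  have hnn : IsNilpotent (Ideal.Quotient.mk P n) :=
    ⟨N, by rw [← map_pow, Ideal.Quotient.eq_zero_iff_mem]; exact hn⟩
  have hun : IsNilpotent (Ideal.Quotient.mk P u) := by
    rw [he, map_sub]
    exact Commute.isNilpotent_sub (Commute.all _ _) hhn hnn
  obtain ⟨m, hm⟩ := hun
  have hum : IsUnit (Ideal.Quotient.mk P u ^ m) := (hu.map _).pow m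
  rwa [hm] at hum

/-- **Elementary change of the second member of a weakly regular pair**: if `(p, q)` is weakly
regular, `u` is a unit and `r` is arbitrary, then `(p, u q + p r)` is weakly regular (modulo `p`
the new element acts as the unit multiple `u q` of `q`). [folklore] -/
theorem isWeaklyRegular_pair_congr {A : Type*} [CommRing A] {p q u : A} (r : A) (hu : IsUnit u)
    (h : RingTheory.Sequence.IsWeaklyRegular A [p, q]) :
    RingTheory.Sequence.IsWeaklyRegular A [p, u * q + p * r] := by
  rw [RingTheory.Sequence.isWeaklyRegular_cons_iff,
    RingTheory.Sequence.isWeaklyRegular_singleton_iff] at h ⊢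
  refine ⟨h.1, ?_⟩
  have hzero : ∀ m : QuotSMulTop p A, p • m = 0 := by
    intro m
    obtain ⟨x, rfl⟩ := Submodule.mkQ_surjective _ m
    rw [Submodule.mkQ_apply, ← Submodule.Quotient.mk_smul, Submodule.Quotient.mk_eq_zero]
    exact Submodule.smul_mem_pointwise_smul x p ⊤ Submodule.mem_top
  have hreg : IsSMulRegular (QuotSMulTop p A) (u * q) := (hu.isSMulRegular _).mul h.2
  have e : ∀ m : QuotSMulTop p A, (u * q + p * r) • m = (u * q) • m := by
    intro m
    rw [add_smul, mul_smul p r, hzero, add_zero]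
  intro m m' hmm'
  apply hreg
  dsimp only at hmm' ⊢
  rwa [e, e] at hmm'

/-! ## The ideal algebra of the two charts, over an arbitrary commutative ring -/

section Algebra

variable {A : Type*} [CommRing A]

/-- **`c`-chart algebra of `K`**: `(c (e τ + cᵏ)) + (c · c^β τ^{β+1}) = (c) · ((e τ + cᵏ) + (c^{(k+1)β+k}))`
for a unit `e` (`e τ ≡ -cᵏ` modulo `e τ + cᵏ`). [folklore] -/
theorem tangentK_cChart {e : A} (he : IsUnit e) (c τ : A) (k β : ℕ) :
    Ideal.span {c * (e * τ + c ^ k)} ⊔ Ideal.span {c * (c ^ β * τ ^ (β + 1))} =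
      Ideal.span {c} * (Ideal.span {e * τ + c ^ k} ⊔ Ideal.span {c ^ ((k + 1) * β + k)}) := by
  rw [Ideal.mul_sup, Ideal.span_singleton_mul_span_singleton, Ideal.span_singleton_mul_span_singleton]
  -- `(c h′) + (c · c^β τ^{β+1}) = (c h′) + (c · c^β (eτ)^{β+1}) = (c h′) + (c · c^β (-cᵏ)^{β+1})`
  have e2 : Ideal.span {c * (c ^ β * τ ^ (β + 1))} = Ideal.span {c * (c ^ β * (e * τ) ^ (β + 1))} := by
    have : c * (c ^ β * (e * τ) ^ (β + 1)) = e ^ (β + 1) * (c * (c ^ β * τ ^ (β + 1))) := by ring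
    rw [this, Ideal.span_singleton_mul_left_unit (he.pow _)]
  have e3 : c * (c ^ β * (e * τ) ^ (β + 1)) - c * (c ^ β * (-(c ^ k)) ^ (β + 1)) ∈
      Ideal.span {c * (e * τ + c ^ k)} := by
    have hdvd : e * τ + c ^ k ∣ (e * τ) ^ (β + 1) - (-(c ^ k)) ^ (β + 1) := by
      have h := sub_dvd_pow_sub_pow (e * τ) (-(c ^ k)) (β + 1)
      have h' : e * τ - -(c ^ k) = e * τ + c ^ k := by ring
      rw [h'] at h
      exact h
    obtain ⟨q, hq⟩ := hdvd
    exact Ideal.mem_span_singleton.mpr ⟨c ^ β * q, by linear_combination (c * c ^ β) * hq⟩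
  have e4 : Ideal.span {c * (c ^ β * (-(c ^ k)) ^ (β + 1))} =
      Ideal.span {c * c ^ ((k + 1) * β + k)} := by
    have : c * (c ^ β * (-(c ^ k)) ^ (β + 1)) = (-1) ^ (β + 1) * (c * c ^ ((k + 1) * β + k)) := by
      ring
    rw [this]
    rcases neg_one_pow_eq_or A (β + 1) with h1 | h1
    · rw [h1, one_mul]
    · rw [h1, neg_one_mul, Ideal.span_singleton_neg]
  rw [e2, sup_span_singleton_eq_of_sub_mem e3, e4]

/-- **`c`-chart algebra of an avatar**: `((c h)ⁱ) + (cⁱ⁺ʲ) = (cⁱ) · ((h)ⁱ + (cʲ))`. [folklore] -/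
theorem tangentFactor_cChart (c h : A) (i j : ℕ) :
    Ideal.span {c * h} ^ i ⊔ Ideal.span {c ^ (i + j)} =
      Ideal.span {c ^ i} * (Ideal.span {h} ^ i ⊔ Ideal.span {c ^ j}) := by
  simp only [Ideal.span_singleton_pow, Ideal.mul_sup, Ideal.span_singleton_mul_span_singleton,
    mul_pow, pow_add]

/-- **`t`-chart algebra of `K`**: `(x (e + xᵏ⁺¹ γᵏ⁺²)) + (x · x^β) = (x)` for a unit `e` (the
residual `(e + xᵏ⁺¹γᵏ⁺², x^β)` is the unit ideal). [folklore] -/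
theorem tangentK_tChart {e : A} (he : IsUnit e) (x γ : A) (k β : ℕ) :
    Ideal.span {x * (e + x ^ (k + 1) * γ ^ (k + 1 + 1))} ⊔ Ideal.span {x * x ^ β} =
      Ideal.span {x} := by
  have hP : Ideal.span {e + x ^ (k + 1) * γ ^ (k + 1 + 1)} ⊔ Ideal.span {x ^ β} = ⊤ := by
    refine eq_top_of_isUnit_eq_sub he (h := e + x ^ (k + 1) * γ ^ (k + 1 + 1))
      (n := x ^ (k + 1) * γ ^ (k + 1 + 1)) (by ring) _ 1 β ?_ ?_
    · rw [pow_one]; exact Ideal.mem_sup_left (Ideal.mem_span_singleton_self _)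
    · refine Ideal.mem_sup_right (Ideal.mem_span_singleton.mpr ⟨x ^ (k * β) * γ ^ ((k + 1 + 1) * β), ?_⟩)
      ring
  calc Ideal.span {x * (e + x ^ (k + 1) * γ ^ (k + 1 + 1))} ⊔ Ideal.span {x * x ^ β}
      = Ideal.span {x} * (Ideal.span {e + x ^ (k + 1) * γ ^ (k + 1 + 1)} ⊔ Ideal.span {x ^ β}) := by
        rw [Ideal.mul_sup, Ideal.span_singleton_mul_span_singleton, Ideal.span_singleton_mul_span_singleton]
    _ = Ideal.span {x} := by rw [hP, Ideal.mul_top]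

/-- **`t`-chart algebra of an avatar**: `((x (e + xᵏ⁺¹γᵏ⁺²))ⁱ) + (xⁱ · xʲ γⁱ⁺ʲ) = (xⁱ)` for a unit `e`.
[folklore] -/
theorem tangentFactor_tChart {e : A} (he : IsUnit e) (x γ : A) (k i j : ℕ) :
    Ideal.span {x * (e + x ^ (k + 1) * γ ^ (k + 1 + 1))} ^ i ⊔ Ideal.span {x ^ i * (x ^ j * γ ^ (i + j))} =
      Ideal.span {x ^ i} := by
  have hP : Ideal.span {(e + x ^ (k + 1) * γ ^ (k + 1 + 1)) ^ i} ⊔ Ideal.span {x ^ j * γ ^ (i + j)} = ⊤ := by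
    refine eq_top_of_isUnit_eq_sub he (h := e + x ^ (k + 1) * γ ^ (k + 1 + 1))
      (n := x ^ (k + 1) * γ ^ (k + 1 + 1)) (by ring) _ i (i + j) ?_ ?_
    · exact Ideal.mem_sup_left (Ideal.mem_span_singleton_self _)
    · refine Ideal.mem_sup_right (Ideal.mem_span_singleton.mpr
        ⟨x ^ (k * (i + j) + i) * γ ^ ((k + 1) * (i + j)), ?_⟩)
      ring
  calc Ideal.span {x * (e + x ^ (k + 1) * γ ^ (k + 1 + 1))} ^ i ⊔ Ideal.span {x ^ i * (x ^ j * γ ^ (i + j))}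
      = Ideal.span {x ^ i} * (Ideal.span {(e + x ^ (k + 1) * γ ^ (k + 1 + 1)) ^ i} ⊔
          Ideal.span {x ^ j * γ ^ (i + j)}) := by
        rw [Ideal.mul_sup, Ideal.span_singleton_mul_span_singleton, Ideal.span_singleton_mul_span_singleton,
          Ideal.span_singleton_pow, mul_pow]
    _ = Ideal.span {x ^ i} := by rw [hP, Ideal.mul_top]

end Algebra

/-! ## Chart images on the two Rees charts of `Bl_{(t, c)} Spec R` -/

section Charts

variable {R : Type u} [CommRing R] (t c η : R)

local notation3 "xx" => (![t, c] : Fin 2 → R)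

/-- `(0 : Fin 2) ≠ 1`. [folklore] -/
theorem zero_ne_one_fin2 : (0 : Fin 2) ≠ 1 := by decide

/-- On the `c`-chart: `t/1 = (c/1) · τ`, `τ = t/c`. [cite: StacksProject, Tag 0804] -/
theorem chartBase_one_t : chartBase xx 1 t = chartBase xx 1 c * chartGen xx 1 0 :=
  reesChartBase_apply_eq_mul_chartGen xx 1 0

/-- On the `t`-chart: `c/1 = (t/1) · γ`, `γ = c/t`. [cite: StacksProject, Tag 0804] -/
theorem chartBase_zero_c : chartBase xx 0 c = chartBase xx 0 t * chartGen xx 0 1 :=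
  reesChartBase_apply_eq_mul_chartGen xx 0 1

/-- **`c`-chart image of the tangent hypersurface**: `(η t + c^{k+1})/1 = (c/1) · (η τ + (c/1)ᵏ)`.
[cite: StacksProject, Tag 0804] -/
theorem chartBase_one_tangent (k : ℕ) :
    chartBase xx 1 (η * t + c ^ (k + 1)) =
      chartBase xx 1 c * (chartBase xx 1 η * chartGen xx 1 0 + chartBase xx 1 c ^ k) := by
  rw [map_add, map_mul, map_pow, chartBase_one_t]
  ring

/-- **`t`-chart image of the tangent hypersurface**: `(η t + c^{k+1})/1 = (t/1) · (η + (t/1)ᵏ γᵏ⁺¹)`.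
[cite: StacksProject, Tag 0804] -/
theorem chartBase_zero_tangent (k : ℕ) :
    chartBase xx 0 (η * t + c ^ (k + 1)) =
      chartBase xx 0 t * (chartBase xx 0 η + chartBase xx 0 t ^ k * chartGen xx 0 1 ^ (k + 1)) := by
  rw [map_add, map_mul, map_pow, chartBase_zero_c]
  ring

/-- **`c`-chart image of `K = (η t + cᵏ⁺¹) + (t^{β+1})`**:
`K · B_c = (c) · ((h′) + (c^{(k+1)(β+1) - 1}))`, `h′ = η τ + cᵏ`. [cite: StacksProject, Tag 0804] -/
theorem map_chartBase_one_tangent (hη : IsUnit η) (k β : ℕ) :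
    (Ideal.span {η * t + c ^ (k + 1)} ⊔ Ideal.span {t ^ (β + 1)}).map (chartBase xx 1) =
      Ideal.span {chartBase xx 1 c} *
        (Ideal.span {chartBase xx 1 η * chartGen xx 1 0 + chartBase xx 1 c ^ k} ⊔
          Ideal.span {chartBase xx 1 c ^ ((k + 1) * β + k)}) := by
  have himt : chartBase xx 1 (t ^ (β + 1)) =
      chartBase xx 1 c * (chartBase xx 1 c ^ β * chartGen xx 1 0 ^ (β + 1)) := by
    rw [map_pow, chartBase_one_t]; ring
  rw [Ideal.map_sup, Ideal.map_span, Set.image_singleton, Ideal.map_span, Set.image_singleton,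
    chartBase_one_tangent, himt]
  exact tangentK_cChart (hη.map _) _ _ k β

/-- **`c`-chart image of an avatar**: `((h)ⁱ + (cⁱ⁺ʲ)) · B_c = (cⁱ) · ((h′)ⁱ + (cʲ))`.
[cite: StacksProject, Tag 0804] -/
theorem map_chartBase_one_tangentFactor (k i j : ℕ) :
    (Ideal.span {η * t + c ^ (k + 1)} ^ i ⊔ Ideal.span {c ^ (i + j)}).map (chartBase xx 1) =
      Ideal.span {chartBase xx 1 c ^ i} *
        (Ideal.span {chartBase xx 1 η * chartGen xx 1 0 + chartBase xx 1 c ^ k} ^ i ⊔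
          Ideal.span {chartBase xx 1 c ^ j}) := by
  rw [Ideal.map_sup, Ideal.map_pow, Ideal.map_span, Set.image_singleton, Ideal.map_span,
    Set.image_singleton, chartBase_one_tangent, map_pow]
  exact tangentFactor_cChart _ _ i j

/-- **`t`-chart image of `K = (η t + cᵏ⁺²) + (t^{β+1})`**: `K · B_t = (t)`.
[cite: StacksProject, Tag 0804] -/
theorem map_chartBase_zero_tangent (hη : IsUnit η) (k β : ℕ) :
    (Ideal.span {η * t + c ^ (k + 1 + 1)} ⊔ Ideal.span {t ^ (β + 1)}).map (chartBase xx 0) =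
      Ideal.span {chartBase xx 0 t} := by
  have himt : chartBase xx 0 (t ^ (β + 1)) = chartBase xx 0 t * chartBase xx 0 t ^ β := by
    rw [map_pow]; ring
  rw [Ideal.map_sup, Ideal.map_span, Set.image_singleton, Ideal.map_span, Set.image_singleton,
    chartBase_zero_tangent, himt]
  exact tangentK_tChart (hη.map _) _ _ k β

/-- **`t`-chart image of an avatar**: `((h)ⁱ + (cⁱ⁺ʲ)) · B_t = (tⁱ)`. [cite: StacksProject, Tag 0804] -/
theorem map_chartBase_zero_tangentFactor (hη : IsUnit η) (k i j : ℕ) :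
    (Ideal.span {η * t + c ^ (k + 1 + 1)} ^ i ⊔ Ideal.span {c ^ (i + j)}).map (chartBase xx 0) =
      Ideal.span {chartBase xx 0 t ^ i} := by
  have himc : chartBase xx 0 (c ^ (i + j)) =
      chartBase xx 0 t ^ i * (chartBase xx 0 t ^ j * chartGen xx 0 1 ^ (i + j)) := by
    rw [map_pow, chartBase_zero_c]; ring
  rw [Ideal.map_sup, Ideal.map_pow, Ideal.map_span, Set.image_singleton, Ideal.map_span,
    Set.image_singleton, chartBase_zero_tangent, himc]
  exact tangentFactor_tChart (hη.map _) _ _ k i j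

/-! ## Re-lettering on the `c`-chart: `(c, h′)` is weakly regular with regular quotient -/

/-- **`(c, η τ + cᵏ⁺¹)` is a weakly regular sequence on the `c`-chart ring** (for `(t, c)`
quasi-regular and `η` a unit): the chart family `(c, τ)` is weakly regular
(`isWeaklyRegular_chartFamily`), and modulo `c` the new element acts as the unit multiple `η τ`
of `τ`. [cite: StacksProject, Tag 0BIQ] -/
theorem isWeaklyRegular_exc_strict (hη : IsUnit η) (hx : IsQuasiRegular xx) (k : ℕ) :
    RingTheory.Sequence.IsWeaklyRegular (chartRing xx 1)
      (List.ofFn (Fin.cons (chartBase xx 1 c)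
        (fun _ : Fin 1 => chartBase xx 1 η * chartGen xx 1 0 + chartBase xx 1 c ^ (k + 1)) :
          Fin 2 → chartRing xx 1)) := by
  let jJ : Fin 1 → {j : Fin 2 // j ≠ 1} := fun _ => ⟨0, zero_ne_one_fin2⟩
  have hjJ : Function.Injective jJ := fun a b _ => Subsingleton.elim a b
  have h0 := CoreRungTower.isWeaklyRegular_chartFamily xx 1 jJ hx hjJ
  rw [List.ofFn_succ, List.ofFn_succ, List.ofFn_zero] at h0 ⊢
  simp only [Fin.cons_zero, Fin.cons_succ] at h0 ⊢
  have h0' : RingTheory.Sequence.IsWeaklyRegular (chartRing xx 1)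
      [chartBase xx 1 c, chartGen xx 1 0] := h0
  have e : chartBase xx 1 η * chartGen xx 1 0 + chartBase xx 1 c ^ (k + 1) =
      chartBase xx 1 η * chartGen xx 1 0 + chartBase xx 1 c * chartBase xx 1 c ^ k := by ring
  rw [e]
  exact isWeaklyRegular_pair_congr (chartBase xx 1 c ^ k) (hη.map _) h0'

/-- The ideals `(c, η τ + cᵏ⁺¹)` and `(c, τ)` of the `c`-chart ring coincide (`η` a unit).
[folklore] -/
theorem span_exc_strict_eq (hη : IsUnit η) (k : ℕ) :
    Ideal.span (Set.range (Fin.cons (chartBase xx 1 c)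
        (fun _ : Fin 1 => chartBase xx 1 η * chartGen xx 1 0 + chartBase xx 1 c ^ (k + 1)) :
          Fin 2 → chartRing xx 1)) =
      Ideal.span (Set.range (Fin.cons (chartBase xx 1 c)
        (fun _ : Fin 1 => chartGen xx 1 0) : Fin 2 → chartRing xx 1)) := by
  rw [Fin.range_cons, Fin.range_cons, Set.range_const, Set.range_const, Ideal.span_insert,
    Ideal.span_insert]
  have hsub : (chartBase xx 1 η * chartGen xx 1 0 + chartBase xx 1 c ^ (k + 1)) -
      chartBase xx 1 η * chartGen xx 1 0 ∈ Ideal.span {chartBase xx 1 c} := by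
    have : (chartBase xx 1 η * chartGen xx 1 0 + chartBase xx 1 c ^ (k + 1)) -
        chartBase xx 1 η * chartGen xx 1 0 = chartBase xx 1 c * chartBase xx 1 c ^ k := by ring
    rw [this]
    exact Ideal.mul_mem_right _ _ (Ideal.mem_span_singleton_self _)
  rw [sup_span_singleton_eq_of_sub_mem hsub, Ideal.span_singleton_mul_left_unit (hη.map _)]

/-- **The quotient of the `c`-chart ring by `(c, η τ + cᵏ⁺¹)` is a regular ring** when `R/(t,c)`
is (`B_c/(c, τ) ≅ R/(t, c)`, `isRegularRing_quot_chartFamily`). [cite: StacksProject, Tag 0BIQ] -/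
theorem isRegularRing_quot_exc_strict (hη : IsUnit η) (hx : IsQuasiRegular xx)
    [IsRegularRing (R ⧸ Ideal.span (Set.range xx))] (k : ℕ) :
    IsRegularRing (chartRing xx 1 ⧸ Ideal.span (Set.range (Fin.cons (chartBase xx 1 c)
      (fun _ : Fin 1 => chartBase xx 1 η * chartGen xx 1 0 + chartBase xx 1 c ^ (k + 1)) :
        Fin 2 → chartRing xx 1))) := by
  let jJ : Fin 1 → {j : Fin 2 // j ≠ 1} := fun _ => ⟨0, zero_ne_one_fin2⟩
  have h0 : IsRegularRing (chartRing xx 1 ⧸ Ideal.span (Set.range (Fin.cons (chartBase xx 1 c)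
      (fun _ : Fin 1 => chartGen xx 1 0) : Fin 2 → chartRing xx 1))) :=
    CoreRungTower.isRegularRing_quot_chartFamily xx 1 jJ hx
  rw [span_exc_strict_eq t c η hη k]
  exact h0

end Charts

end CoreRungTower

end Summit.ResolutionOfSingularities.ResolutionOfSingularities.Theorems

end
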